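import Literature.NumberTheory.EllipticCurves.ModularParamIntegralityProofs
import Literature.NumberTheory.EllipticCurves.ModularParamFormalLogProofs
import Literature.RingTheory.FormalGroups.HondaTypeTransport
import Literature.NumberTheory.EllipticCurves.PeriodLatticeRationalityUnconditionalProofs
import Literature.NumberTheory.EllipticCurves.PointCountHasseInvariantProofs
import Literature.NumberTheory.EllipticCurves.HasseElementary
import Literature.NumberTheory.EllipticCurves.FormalLogExpBaseChangeProofs
import Literature.NumberTheory.EllipticCurves.LFunctionSmulProofs
import Literature.NumberTheory.EllipticCurves.ModularityVersionAp
import Literature.NumberTheory.EllipticCurves.RealLatticePeriod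
import Literature.NumberTheory.Automorphic.LangWave0Proofs
import HarnessLib

/-!
# The Eichler–Shimura congruence for `ℂ/Λ_f` by Honda's formal-group method, and
# `IsNewformOf.exists_maninConstant_ne_zero` from Faltings' isogeny theorem alone

Topic `NumberTheory/EllipticCurves`; a proofs-only file (theorems only, no definitions, no named
facts), serving the named fact `IsNewformOf.exists_maninConstant_ne_zero`
(`ModularParametrizationDegree.lean`; Breuil–Conrad–Diamond–Taylor 2001, p. 845: "(2) ⇒ (6)
follows from a construction of Shimura and a theorem of Faltings"). The tree had reduced that
fact to two inputs (`exists_maninConstant_ne_zero_of_congruenceRelation_cofinite`,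
`PeriodLatticeRationalityUnconditionalProofs`): Faltings' isogeny theorem
(`WeierstrassCurve.isIsogenous_iff_frobeniusTrace_eq`) and the *Eichler–Shimura congruence
relation* `a_p(f) = a_p(E_f)` for almost all `p`, for the curve `E_f = ℂ/Λ_f` (Shimura 1971,
Thm. 7.15), classically proved on the reduction of `X₀(N)` and `J₀(N)` modulo `p` (Igusa).

**This file proves the congruence relation for the newform of a given elliptic curve `W/ℚ`
without any modular curve in positive characteristic**, by the method of Honda (J. Math. Soc.
Japan 22 (1970), §6.2, pp. 241–242 — carried out there for `X₀(N)` of genus one with the local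
parameter `j(z)⁻¹`; here with the parameter `z = −X/Y` of a short model `E₀` of `ℂ/Λ_f`):

1. `log_{E₀}(z(q)) = Σ aₙ(f)qⁿ/n` along the analytic modular parametrisation
   (`IsXPresentation.exists_formalLog_subst_eq`, `ModularParamFormalLogProofs`);
2. `z(q) ∈ ℚ⟦q⟧` with bounded denominators (`exists_int_series_of_mul_yFn_eq`,
   `ModularParamIntegralityProofs`: Galois descent + Shimura's integral basis), hence
   `z(q) ∈ ℤ_p⟦q⟧`, `z ≡ q (mod deg 2)`, for all `p` off a finite set;
3. `Σ aₙqⁿ/n` is of Honda type `p − a_pT + T²` (`a_{pn} = a_paₙ − pa_{n/p}`, `p ∤ N`;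
   `norm_coeff_hondaShift_mk_div_le_one`), so by Honda's Lemma 2.3 (transport along the integral
   substitution `z⁻¹`, `norm_coeff_hondaShift_subst_le_one`, `HondaTypeTransport`) `log_{E₀}` is of
   the same type, whence `c_{p-1}(ω_{E₀}) ≡ a_p(f) (mod p)` (`dvd_sub_of_hondaShift`);
4. `c_{p-1}(ω_{E₀}) ≡ A_p ≡ a_p(E₀) (mod p)` (Deuring/Hasse: the Hasse invariant is the
   `z^{p-1}`-coefficient of `ω`, `coeff_formalInvDiff_prime_sub_one`; Silverman AEC V.4.1(a),
   `cast_card_add_one_sub_natCard_point`);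
5. `|a_p(E₀)| ≤ 2√p` (Hasse, `abs_natCard_point_sub_le_of_ringChar_ne`) and
   `|a_p(f)| = |a_p(W)| ≤ 2√p` (Hasse for `W`), so `a_p(f) = a_p(E₀)` for `p > 16`.

With Faltings' theorem this gives `E₀ ~_ℚ W`, and `ℚ`-isogenous curves have commensurable
Néron lattices (`neronLattice_commensurable_of_isIsogenous_holds`):

* `IsNewformOf.finite_setOf_cuspCoeff_ne_lFunction_shortModel` — the cofinite congruence
  relation for the model of `ℂ/Λ_f` attached to the newform of `W`;
* `IsNewformOf.exists_maninConstant_ne_zero_of_faltings` — **the named fact from Faltings'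
  isogeny theorem alone**.

## References

* T. Honda, *On the theory of commutative formal groups*, J. Math. Soc. Japan 22 (1970), §6.1
  Thm. 8, §6.2 Thm. 9 and pp. 241–242 (held, read). [Honda1970]
* C. Breuil, B. Conrad, F. Diamond, R. Taylor, JAMS 14 (2001), p. 845. [BCDTJAMS2001]
* G. Shimura, *Introduction to the arithmetic theory of automorphic functions* (1971), Thm. 3.52,
  Thm. 7.14, Thm. 7.15. [ShimuraIATAF1971]
* J. H. Silverman, *AEC*, 2nd ed. (2009), IV.1, V.1.1, V.4.1(a). [SilvermanAEC2009]
* G. Faltings, Invent. Math. 73 (1983), §5 Kor. 2. [Faltings1983Endlichkeit]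
-/

noncomputable section

open Complex Filter Topology Set Function PowerSeries
open UpperHalfPlane hiding I
open scoped Real Topology Manifold MatrixGroups PeriodPair ModularForm WithZero
open ModularForm CongruenceSubgroup

open Literature.NumberTheory.EllipticCurves Literature.RingTheory.FormalGroups

namespace Literature.NumberTheory.EllipticCurves.ModularForms

/-! ### The arithmetic side: `c_{p-1}(ω) ≡ a_p (mod p)` and Hasse for an integral model -/

section Arithmetic

open Literature.NumberTheory.Automorphic (numPointsMod frobeniusTrace)

/-- The reduction modulo a prime `p ∤ Δ` of an integral Weierstrass equation is an elliptic
curve over `𝔽_p`. [Silverman AEC VII.5.1(a)] [folklore] -/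
theorem isElliptic_map_zmod_of_not_dvd (E : WeierstrassCurve ℤ) {p : ℕ} [Fact p.Prime]
    (hpΔ : ¬ (p : ℤ) ∣ E.Δ) : (E.map (Int.castRingHom (ZMod p))).IsElliptic :=
  ⟨by
    rw [WeierstrassCurve.map_Δ, isUnit_iff_ne_zero, eq_intCast, ne_eq,
      ZMod.intCast_zmod_eq_zero_iff_dvd]
    exact hpΔ⟩

/-- **`c_{p-1}(ω_E) ≡ a_p(E) (mod p)`** for an integral Weierstrass equation `E` and an odd prime
`p ∤ Δ_E`: the coefficient of `z^{p-1}` of the invariant differential `ω = Σ cₙzⁿdz` (over `ℤ`,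
`formalInvDiff`) reduces to the Hasse invariant `A_p` of `E mod p` (Deuring; the tree's
`coeff_formalInvDiff_prime_sub_one`), and `A_p = p + 1 − #E(𝔽_p)` in `𝔽_p` (Silverman AEC
V.4.1(a); `cast_card_add_one_sub_natCard_point`). [cite: SilvermanAEC2009, Thm. V.4.1 (a)] -/
theorem dvd_coeff_formalInvDiff_sub_frobeniusTrace (E : WeierstrassCurve ℤ) {p : ℕ} [hp : Fact p.Prime]
    (hp2 : p ≠ 2) (hpΔ : ¬ (p : ℤ) ∣ E.Δ) :
    (p : ℤ) ∣ PowerSeries.coeff (p - 1) E.formalInvDiff - frobeniusTrace E p := by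
  haveI := isElliptic_map_zmod_of_not_dvd E hpΔ
  obtain ⟨m, hpm⟩ : ∃ m, p = 2 * m + 1 := hp.out.eq_two_or_odd'.resolve_left hp2
  rw [← ZMod.intCast_zmod_eq_zero_iff_dvd, Int.cast_sub, sub_eq_zero]
  have h1 : ((PowerSeries.coeff (p - 1) E.formalInvDiff : ℤ) : ZMod p) =
      (E.map (Int.castRingHom (ZMod p))).hasseCoeff p := by
    rw [← WeierstrassCurve.coeff_formalInvDiff_prime_sub_one _ p hpm,
      ← WeierstrassCurve.map_formalInvDiff, PowerSeries.coeff_map, eq_intCast]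
  have h2 : ((frobeniusTrace E p : ℤ) : ZMod p) = (E.map (Int.castRingHom (ZMod p))).hasseCoeff p := by
    have hchar : ringChar (ZMod p) ≠ 2 := by rw [ZMod.ringChar_zmod_n]; exact hp2
    have := (E.map (Int.castRingHom (ZMod p))).cast_card_add_one_sub_natCard_point hchar
    rw [ZMod.card] at this
    rw [frobeniusTrace, numPointsMod]
    exact this
  rw [h1, h2]

/-- **Hasse's theorem for the reduction of an integral model**: `|a_p(E)| ≤ 2√p` for a prime
`p ≥ 5` not dividing `Δ_E` (`a_p = p + 1 − #E(𝔽_p)`; Manin's elementary proof in the tree,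
`abs_natCard_point_sub_le_of_ringChar_ne`). [cite: SilvermanAEC2009, Thm. V.1.1] -/
theorem abs_frobeniusTrace_le (E : WeierstrassCurve ℤ) {p : ℕ} [hp : Fact p.Prime] (hp2 : p ≠ 2)
    (hp3 : p ≠ 3) (hpΔ : ¬ (p : ℤ) ∣ E.Δ) :
    |(frobeniusTrace E p : ℝ)| ≤ 2 * Real.sqrt p := by
  haveI := isElliptic_map_zmod_of_not_dvd E hpΔ
  have h2 : ringChar (ZMod p) ≠ 2 := by rw [ZMod.ringChar_zmod_n]; exact hp2
  have h3 : ringChar (ZMod p) ≠ 3 := by rw [ZMod.ringChar_zmod_n]; exact hp3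
  have := (E.map (Int.castRingHom (ZMod p))).abs_natCard_point_sub_le_of_ringChar_ne h2 h3
  rw [ZMod.card, abs_sub_comm] at this
  rw [frobeniusTrace, numPointsMod]
  push_cast
  exact this

/-- **An integral model of a Weierstrass equation over `ℚ`**: clearing denominators,
`(1/D, 0, 0, 0) • W` (i.e. `aᵢ ↦ Dⁱaᵢ`) has integer coefficients for
`D = ∏ den(aᵢ)`. [Silverman AEC VII.1 (Remark 1.1), VIII.8] [folklore] -/
theorem exists_intModel (W : WeierstrassCurve ℚ) :
    ∃ (D : ℕ) (hD : (D : ℚ) ≠ 0) (EW : WeierstrassCurve ℤ),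
      EW.map (Int.castRingHom ℚ) =
        (⟨(Units.mk0 (D : ℚ) hD)⁻¹, 0, 0, 0⟩ : WeierstrassCurve.VariableChange ℚ) • W := by
  set D : ℕ := W.a₁.den * W.a₂.den * W.a₃.den * W.a₄.den * W.a₆.den with hDdef
  have hDpos : 0 < D := by
    simp only [hDdef]
    exact Nat.mul_pos (Nat.mul_pos (Nat.mul_pos (Nat.mul_pos W.a₁.den_pos W.a₂.den_pos)
      W.a₃.den_pos) W.a₄.den_pos) W.a₆.den_pos
  have hD : (D : ℚ) ≠ 0 := by exact_mod_cast hDpos.ne'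
  -- `D q ∈ ℤ` whenever `den q ∣ D`
  have hint : ∀ q : ℚ, q.den ∣ D → ∃ z : ℤ, (D : ℚ) * q = z := by
    intro q hq
    obtain ⟨c, hc⟩ := hq
    refine ⟨c * q.num, ?_⟩
    rw [hc, Nat.cast_mul, mul_comm (q.den : ℚ), mul_assoc, Rat.den_mul_eq_num]
    push_cast; ring
  have hpow : ∀ (q : ℚ) (i : ℕ), q.den ∣ D → ∃ z : ℤ, (D : ℚ) ^ (i + 1) * q = z := by
    intro q i hq
    obtain ⟨z, hz⟩ := hint q hq
    exact ⟨(D : ℤ) ^ i * z, by rw [pow_succ, mul_assoc, hz]; push_cast; ring⟩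
  have hd₁ : W.a₁.den ∣ D := ⟨W.a₂.den * W.a₃.den * W.a₄.den * W.a₆.den, by rw [hDdef]; ring⟩
  have hd₂ : W.a₂.den ∣ D := ⟨W.a₁.den * W.a₃.den * W.a₄.den * W.a₆.den, by rw [hDdef]; ring⟩
  have hd₃ : W.a₃.den ∣ D := ⟨W.a₁.den * W.a₂.den * W.a₄.den * W.a₆.den, by rw [hDdef]; ring⟩
  have hd₄ : W.a₄.den ∣ D := ⟨W.a₁.den * W.a₂.den * W.a₃.den * W.a₆.den, by rw [hDdef]; ring⟩
  have hd₆ : W.a₆.den ∣ D := ⟨W.a₁.den * W.a₂.den * W.a₃.den * W.a₄.den, by rw [hDdef]; ring⟩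
  obtain ⟨z₁, hz₁⟩ := hpow W.a₁ 0 hd₁
  obtain ⟨z₂, hz₂⟩ := hpow W.a₂ 1 hd₂
  obtain ⟨z₃, hz₃⟩ := hpow W.a₃ 2 hd₃
  obtain ⟨z₄, hz₄⟩ := hpow W.a₄ 3 hd₄
  obtain ⟨z₆, hz₆⟩ := hpow W.a₆ 5 hd₆
  refine ⟨D, hD, ⟨z₁, z₂, z₃, z₄, z₆⟩, ?_⟩
  ext
  · rw [WeierstrassCurve.map_a₁, WeierstrassCurve.variableChange_a₁, eq_intCast, ← hz₁, inv_inv,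
      Units.val_mk0]
    ring
  · rw [WeierstrassCurve.map_a₂, WeierstrassCurve.variableChange_a₂, eq_intCast, ← hz₂, inv_inv,
      Units.val_mk0]
    ring
  · rw [WeierstrassCurve.map_a₃, WeierstrassCurve.variableChange_a₃, eq_intCast, ← hz₃, inv_inv,
      Units.val_mk0]
    ring
  · rw [WeierstrassCurve.map_a₄, WeierstrassCurve.variableChange_a₄, eq_intCast, ← hz₄, inv_inv,
      Units.val_mk0]
    ring
  · rw [WeierstrassCurve.map_a₆, WeierstrassCurve.variableChange_a₆, eq_intCast, ← hz₆, inv_inv,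
      Units.val_mk0]
    ring

/-- **Hasse's bound for the Dirichlet coefficients of `L(W, s)` at almost all primes**: for every
Weierstrass equation `W` of an elliptic curve over `ℚ` there is `M ≠ 0` with `|a_p(W)| ≤ 2√p` for
all primes `p ∤ M` (`a_p(W)` = Mathlib's `W.LFunction p`; via an integral model `E_W ≅ W`,
`LFunction_smul`, `a_p(E_W) = p + 1 − #E_W(𝔽_p)` for `p ∤ Δ`, and Hasse).
[cite: SilvermanAEC2009, Thm. V.1.1] -/
theorem exists_abs_lFunction_le (W : WeierstrassCurve ℚ) [W.IsElliptic] :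
    ∃ M : ℕ, M ≠ 0 ∧ ∀ p : ℕ, p.Prime → ¬ p ∣ M → |((W.LFunction p : ℤ) : ℝ)| ≤ 2 * Real.sqrt p := by
  obtain ⟨D, hD, EW, hEW⟩ := exists_intModel W
  set C : WeierstrassCurve.VariableChange ℚ := ⟨(Units.mk0 (D : ℚ) hD)⁻¹, 0, 0, 0⟩ with hC
  have hΔ : EW.Δ ≠ 0 := by
    intro h0
    have h1 : (EW.map (Int.castRingHom ℚ)).Δ = 0 := by rw [WeierstrassCurve.map_Δ, h0, map_zero]
    rw [hEW] at h1
    haveI : (C • W).IsElliptic := inferInstance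
    exact (C • W).Δ'.ne_zero (by rw [WeierstrassCurve.coe_Δ']; exact h1)
  refine ⟨6 * EW.Δ.natAbs, mul_ne_zero (by norm_num) (Int.natAbs_ne_zero.mpr hΔ), fun p hp hpM ↦ ?_⟩
  haveI := Fact.mk hp
  have hp2 : p ≠ 2 := by rintro rfl; exact hpM (dvd_mul_of_dvd_left (by norm_num) _)
  have hp3 : p ≠ 3 := by rintro rfl; exact hpM (dvd_mul_of_dvd_left (by norm_num) _)
  have hpΔ : ¬ (p : ℤ) ∣ EW.Δ := by
    intro h; exact hpM (dvd_mul_of_dvd_right (Int.natCast_dvd.mp h) _)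
  have hL : W.LFunction p = frobeniusTrace EW p := by
    rw [← Literature.NumberTheory.Automorphic.lFunction_map_apply_prime_of_not_dvd EW hp hpΔ, hEW,
      WeierstrassCurve.LFunction_smul]
  rw [hL]
  exact abs_frobeniusTrace_le EW hp2 hp3 hpΔ

end Arithmetic

/-! ### The Hecke recursion of the newform of `W` gives the Honda type over `ℚ_p` -/

section HeckeType

variable {N : ℕ} [NeZero N]

/-- **The Hecke recursion at `p ∤ N` for the Dirichlet coefficients of `L(W, s)`**, read off the
newform of `W`: `a_{pm}(W) = a_p(W)a_m(W) − p·a_{m/p}(W)` (Diamond–Shurman Prop. 5.8.5 for `f`,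
`aₙ(f) = aₙ(W)`). [cite: DiamondShurman2005, Prop. 5.8.5] -/
theorem IsNewformOf.lFunction_prime_mul {W : WeierstrassCurve ℚ} {f : CuspForm (Gamma0 N) 2}
    (hf : IsNewformOf W f) {p : ℕ} (hp : p.Prime) (hpN : ¬ p ∣ N) (m : ℕ) :
    (W.LFunction (p * m) : ℤ) =
      W.LFunction p * W.LFunction m - p * (if p ∣ m then W.LFunction (m / p) else 0) := by
  have h := hf.1.cuspCoeff_prime_mul hp m
  rw [if_neg hpN, show (2 : ℤ) - 1 = 1 by norm_num, zpow_one, hf.2, hf.2, hf.2] at h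
  have hc : ((W.LFunction (p * m) : ℤ) : ℂ) =
      ((W.LFunction p * W.LFunction m - p * (if p ∣ m then W.LFunction (m / p) else 0) : ℤ) : ℂ) := by
    rw [h]
    split_ifs with hpm
    · rw [hf.2]; push_cast; ring
    · push_cast; ring
  exact_mod_cast hc

/-- **`Σ aₙ(W) Xⁿ/n` is of Honda type `p − a_pT + T²` over `ℚ_p`** for `p ∤ N` (`aₙ(W)` the
Dirichlet coefficients of `L(W, s)`, read off the newform of `W`; Honda 1970, (6.2) with Thm. 8).
[cite: Honda1970, Thm. 8 with (6.2)] -/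
theorem IsNewformOf.norm_coeff_hondaShift_le_one {W : WeierstrassCurve ℚ} {f : CuspForm (Gamma0 N) 2}
    (hf : IsNewformOf W f) {p : ℕ} [hp : Fact p.Prime] (hpN : ¬ p ∣ N) (n : ℕ) :
    ‖PowerSeries.coeff n (hondaShift p ((W.LFunction p : ℤ) : ℚ_[p])
      (PowerSeries.mk fun k ↦ ((W.LFunction k : ℤ) : ℚ_[p]) / k))‖ ≤ 1 := by
  refine norm_coeff_hondaShift_mk_div_le_one (fun k ↦ ((W.LFunction k : ℤ) : ℚ_[p])) ?_ ?_ ?_ n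
  · rw [ArithmeticFunction.map_zero, Int.cast_zero]
  · intro m hm
    rw [hf.lFunction_prime_mul hp.out hpN m]
    split_ifs <;> push_cast <;> ring
  · intro m
    exact Padic.norm_int_le_one _

end HeckeType

/-! ### `p`-integrality of `z_p` and the inverse of an integral unit series -/

section PadicSeries

variable {p : ℕ} [hp : Fact p.Prime]

/-- The multiplicative inverse of `U ∈ ℤ_p⟦X⟧` with `‖U(0)‖ = 1` is integral. [folklore] -/
theorem norm_coeff_inv_le_one {U : ℚ_[p]⟦X⟧} (hU : ∀ n, ‖PowerSeries.coeff n U‖ ≤ 1)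
    (hU0 : ‖PowerSeries.constantCoeff U‖ = 1) (n : ℕ) : ‖PowerSeries.coeff n U⁻¹‖ ≤ 1 := by
  set Θ := liftInt U hU with hΘ
  have hΘ0 : ‖PowerSeries.constantCoeff Θ‖ = 1 := by
    rw [← PowerSeries.coeff_zero_eq_constantCoeff_apply, hΘ, liftInt, PowerSeries.coeff_mk, PadicInt.norm_def]
    rw [← PowerSeries.coeff_zero_eq_constantCoeff_apply] at hU0
    exact hU0
  obtain ⟨u, hu⟩ : IsUnit (PowerSeries.constantCoeff Θ) := PadicInt.isUnit_iff.mpr hΘ0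
  set Ψ := PowerSeries.invOfUnit Θ u with hΨ
  have hΘΨ : Θ * Ψ = 1 := PowerSeries.mul_invOfUnit Θ u hu.symm
  have hmap : U * Ψ.map PadicInt.Coe.ringHom = 1 := by
    have := congrArg (PowerSeries.map (PadicInt.Coe.ringHom (p := p))) hΘΨ
    rwa [map_mul, map_liftInt, map_one] at this
  have hU00 : PowerSeries.constantCoeff U ≠ 0 := by
    intro h0; rw [h0, norm_zero] at hU0; exact zero_ne_one hU0
  have hinv : U⁻¹ = Ψ.map PadicInt.Coe.ringHom := by
    have h2 : U⁻¹ * U = 1 := PowerSeries.inv_mul_cancel U hU00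
    calc U⁻¹ = U⁻¹ * (U * Ψ.map PadicInt.Coe.ringHom) := by rw [hmap, mul_one]
      _ = Ψ.map PadicInt.Coe.ringHom := by rw [← mul_assoc, h2, one_mul]
  rw [hinv, PowerSeries.coeff_map]
  exact (PowerSeries.coeff n Ψ).2

/-- Integer series are integral in `ℚ_p⟦X⟧`. [folklore] -/
theorem norm_coeff_map_int_le_one (Q : ℤ⟦X⟧) (n : ℕ) :
    ‖PowerSeries.coeff n (Q.map (Int.castRingHom ℚ_[p]))‖ ≤ 1 := by
  rw [PowerSeries.coeff_map, eq_intCast]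
  exact Padic.norm_int_le_one _

/-- **`p`-integrality from bounded denominators.** If `z ∈ ℚ_p⟦X⟧` satisfies `z·Q = P` with
`P, Q ∈ ℤ⟦X⟧` (mapped to `ℚ_p`) and the leading coefficient of `Q` is prime to `p`, then
`z ∈ ℤ_p⟦X⟧`: writing `Q = X^m Q₁` with `Q₁(0)` a `p`-adic unit, `z·Q₁ = P/X^m` is integral
and `Q₁⁻¹ ∈ ℤ_p⟦X⟧`. [folklore] -/
theorem norm_coeff_le_one_of_mul_eq {z : ℚ_[p]⟦X⟧} {P Q : ℤ⟦X⟧}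
    (hlead : ¬ (p : ℤ) ∣ PowerSeries.coeff Q.order.toNat Q)
    (hz : z * Q.map (Int.castRingHom ℚ_[p]) = P.map (Int.castRingHom ℚ_[p])) (n : ℕ) :
    ‖PowerSeries.coeff n z‖ ≤ 1 := by
  set m := Q.order.toNat with hm
  set Q₁ : ℚ_[p]⟦X⟧ := (PowerSeries.divXPowOrder Q).map (Int.castRingHom ℚ_[p]) with hQ₁
  have hQfac : Q.map (Int.castRingHom ℚ_[p]) = PowerSeries.X ^ m * Q₁ := by
    rw [hQ₁, ← PowerSeries.X_pow_order_mul_divXPowOrder (f := Q), map_mul, map_pow, PowerSeries.map_X,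
      PowerSeries.X_pow_order_mul_divXPowOrder]
  have hQ₁int : ∀ k, ‖PowerSeries.coeff k Q₁‖ ≤ 1 := fun k ↦ norm_coeff_map_int_le_one _ k
  have hQ₁0 : ‖PowerSeries.constantCoeff Q₁‖ = 1 := by
    rw [hQ₁, ← PowerSeries.coeff_zero_eq_constantCoeff_apply, PowerSeries.coeff_map,
      PowerSeries.coeff_divXPowOrder, zero_add, eq_intCast]
    refine le_antisymm (Padic.norm_int_le_one _) (not_lt.mp fun hlt ↦ hlead ?_)
    exact Padic.norm_intCast_lt_one_iff.mp hlt
  -- `z·Q₁` is integral: its coefficients are those of `P` shifted by `m`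
  have hzQ₁ : ∀ k, ‖PowerSeries.coeff k (z * Q₁)‖ ≤ 1 := by
    intro k
    have h1 : PowerSeries.X ^ m * (z * Q₁) = P.map (Int.castRingHom ℚ_[p]) := by
      rw [← hz, hQfac]; ring
    have h2 : PowerSeries.coeff (k + m) (PowerSeries.X ^ m * (z * Q₁)) = PowerSeries.coeff k (z * Q₁) := by
      rw [PowerSeries.coeff_X_pow_mul', if_pos (Nat.le_add_left m k), Nat.add_sub_cancel]
    rw [← h2, h1]
    exact norm_coeff_map_int_le_one _ _
  have hQ₁ne : PowerSeries.constantCoeff Q₁ ≠ 0 := by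
    intro h0; rw [h0, norm_zero] at hQ₁0; exact zero_ne_one hQ₁0
  have hzeq : z = (z * Q₁) * Q₁⁻¹ := by
    rw [mul_assoc, PowerSeries.mul_inv_cancel Q₁ hQ₁ne, mul_one]
  rw [hzeq]
  exact norm_coeff_mul_le_of_le_one zero_le_one hzQ₁ (norm_coeff_inv_le_one hQ₁int hQ₁0) n

/-- `[X¹] ℓ(z) = [X¹]ℓ · [X¹]z` for `ℓ(0) = z(0) = 0`. [folklore] -/
theorem coeff_one_subst_of_constantCoeff_eq_zero {ℓ z : ℚ_[p]⟦X⟧} (hℓ : PowerSeries.constantCoeff ℓ = 0)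
    (hz : PowerSeries.constantCoeff z = 0) :
    PowerSeries.coeff 1 (ℓ.subst z) = PowerSeries.coeff 1 ℓ * PowerSeries.coeff 1 z := by
  rw [coeff_subst_eq_sum hz, Finset.sum_range_succ, Finset.sum_range_one, pow_zero, pow_one,
    PowerSeries.coeff_zero_eq_constantCoeff_apply, hℓ, zero_mul, zero_add]

end PadicSeries

/-! ### Honda's congruence `a_p ≡ a_p(E₀) (mod p)` for one prime -/

section OnePrime

open Literature.NumberTheory.Automorphic (numPointsMod frobeniusTrace)

variable {p : ℕ} [hp : Fact p.Prime]

/-- **Honda's congruence for one prime.** Let `E₀` be an integral Weierstrass equation, `p` an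
odd prime with `p ∤ Δ_{E₀}`, and `(aₙ)` integers with `a₀ = 0`, `a₁ = 1` and the Hecke recursion
`a_{pn} = a_paₙ − pa_{n/p}` at `p`. Suppose `z ∈ ℚ⟦X⟧`, `z(0) = 0`, satisfies
`log_{E₀}(z) = Σ aₙXⁿ/n` and `z·Q = P` for integer series `P, Q` with the leading coefficient of
`Q` prime to `p`. Then `a_p ≡ a_p(E₀) (mod p)`, `a_p(E₀) = p + 1 − #E₀(𝔽_p)`. This is the chain
(6.6)–(6.9) of Honda 1970, §6.2, with the type comparison done modulo `p` only: `z ∈ ℤ_p⟦X⟧`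
(`norm_coeff_le_one_of_mul_eq`), `Σ aₙXⁿ/n` is of type `p − a_pT + T²` (Thm. 8), hence so is
`log_{E₀} = (Σ aₙXⁿ/n) ∘ z⁻¹` (Lemma 2.3), so `c_{p-1}(ω) ≡ a_p (mod p)`, while
`c_{p-1}(ω) ≡ A_p ≡ a_p(E₀)` (Deuring, Silverman AEC V.4.1(a)).
[cite: Honda1970, §6.2 (6.6)–(6.9), pp. 241–242] [cite: SilvermanAEC2009, Thm. V.4.1 (a)] -/
theorem dvd_sub_frobeniusTrace_of_formalLog_subst_eq (E₀ : WeierstrassCurve ℤ) (hp2 : p ≠ 2)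
    (hpΔ : ¬ (p : ℤ) ∣ E₀.Δ) (a : ℕ → ℤ) (ha0 : a 0 = 0) (ha1 : a 1 = 1)
    (hrec : ∀ n, 0 < n → a (p * n) = a p * a n - p * (if p ∣ n then a (n / p) else 0))
    {z : ℚ⟦X⟧} (hz0 : PowerSeries.constantCoeff z = 0)
    (hlog : (E₀.map (Int.castRingHom ℚ)).formalLog.subst z = PowerSeries.mk fun n ↦ (a n : ℚ) / n)
    {P Q : ℤ⟦X⟧} (hlead : ¬ (p : ℤ) ∣ PowerSeries.coeff Q.order.toNat Q)
    (hzQ : z * Q.map (Int.castRingHom ℚ) = P.map (Int.castRingHom ℚ)) :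
    (p : ℤ) ∣ a p - frobeniusTrace E₀ p := by
  -- everything over `ℚ_p`
  set ι : ℚ →+* ℚ_[p] := algebraMap ℚ ℚ_[p] with hι
  set zp : ℚ_[p]⟦X⟧ := z.map ι with hzp
  set ℓ : ℚ_[p]⟦X⟧ := (E₀.map (Int.castRingHom ℚ_[p])).formalLog with hℓ
  set u : ℚ_[p]⟦X⟧ := PowerSeries.mk fun n ↦ ((a n : ℤ) : ℚ_[p]) / n with hu
  have hzp0 : PowerSeries.constantCoeff zp = 0 := by
    rw [hzp, ← PowerSeries.coeff_zero_eq_constantCoeff_apply, PowerSeries.coeff_map,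
      PowerSeries.coeff_zero_eq_constantCoeff_apply, hz0, map_zero]
  have hzps : PowerSeries.HasSubst zp := PowerSeries.HasSubst.of_constantCoeff_zero' hzp0
  -- the log identity over `ℚ_p`
  have hlogp : ℓ.subst zp = u := by
    have hE : (E₀.map (Int.castRingHom ℚ)).map ι = E₀.map (Int.castRingHom ℚ_[p]) := by
      rw [WeierstrassCurve.map_map, RingHom.ext_int (ι.comp (Int.castRingHom ℚ)) (Int.castRingHom ℚ_[p])]
    have := congrArg (PowerSeries.map ι) hlog
    rw [map_subst_apply (PowerSeries.HasSubst.of_constantCoeff_zero' hz0), WeierstrassCurve.map_formalLog, hE] at this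
    rw [hℓ, hzp, this, hu]
    ext n
    simp only [PowerSeries.coeff_map, PowerSeries.coeff_mk, map_div₀, map_natCast, hι, eq_ratCast,
      Rat.cast_intCast]
  -- `z_p = X + ⋯` is integral
  have hzQp : zp * Q.map (Int.castRingHom ℚ_[p]) = P.map (Int.castRingHom ℚ_[p]) := by
    have hmm : ∀ φ : ℤ⟦X⟧, (φ.map (Int.castRingHom ℚ)).map ι = φ.map (Int.castRingHom ℚ_[p]) := by
      intro φ; ext n; simp [PowerSeries.coeff_map, hι]
    have := congrArg (PowerSeries.map ι) hzQ
    rwa [map_mul, hmm, hmm] at this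
  have hzint : ∀ n, ‖PowerSeries.coeff n zp‖ ≤ 1 := norm_coeff_le_one_of_mul_eq hlead hzQp
  have hℓ0 : PowerSeries.constantCoeff ℓ = 0 := WeierstrassCurve.constantCoeff_formalLog _
  have hℓ1 : PowerSeries.coeff 1 ℓ = 1 := WeierstrassCurve.coeff_one_formalLog _
  have hz1 : PowerSeries.coeff 1 zp = 1 := by
    have := congrArg (PowerSeries.coeff 1) hlogp
    rw [coeff_one_subst_of_constantCoeff_eq_zero hℓ0 hzp0, hℓ1, one_mul, hu, PowerSeries.coeff_mk,
      Nat.cast_one, div_one, ha1, Int.cast_one] at this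
    exact this
  have hzu : IsUnit (PowerSeries.coeff 1 zp) := by rw [hz1]; exact isUnit_one
  -- `ℓ = u ∘ z_p⁻¹`, so `ℓ` is of Honda type `p − a_pT + T²`
  set θ := PowerSeries.substInvOfIsUnit zp hzu with hθ
  have hθ0 : PowerSeries.constantCoeff θ = 0 := PowerSeries.constantCoeff_substInvOfIsUnit _ _
  have hθint : ∀ n, ‖PowerSeries.coeff n θ‖ ≤ 1 := norm_coeff_substInvOfIsUnit_le_one hzp0 hz1 hzint hzu
  have hℓu : ℓ = u.subst θ := by
    have h1 : PowerSeries.subst θ (ℓ.subst zp) = ℓ.subst (zp.subst θ) :=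
      PowerSeries.subst_comp_subst_apply hzps (PowerSeries.HasSubst.substInvOfIsUnit _ _) ℓ
    rw [PowerSeries.subst_substInvOfIsUnit_right zp hzp0 hzu, PowerSeries.X_subst, hlogp] at h1
    exact h1.symm
  have ha_int : ∀ n, ‖((a n : ℤ) : ℚ_[p])‖ ≤ 1 := fun n ↦ Padic.norm_int_le_one _
  have hTu : ∀ n, ‖PowerSeries.coeff n (hondaShift p ((a p : ℤ) : ℚ_[p]) u)‖ ≤ 1 := by
    have h := norm_coeff_hondaShift_mk_div_le_one (p := p) (fun n ↦ ((a n : ℤ) : ℚ_[p]))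
      (by rw [ha0, Int.cast_zero]) (fun n hn ↦ by rw [hrec n hn]; split_ifs <;> push_cast <;> ring) ha_int
    rw [hu]; exact h
  have hTℓ : ∀ n, ‖PowerSeries.coeff n (hondaShift p ((a p : ℤ) : ℚ_[p]) ℓ)‖ ≤ 1 := by
    rw [hℓu]; exact norm_coeff_hondaShift_subst_le_one (ha_int p) hTu hθ0 hθint
  -- read off: `p·[Xᵖ]ℓ = c_{p-1}(ω) ∈ ℤ`
  have hp2' : 2 ≤ p := hp.out.two_le
  obtain ⟨k, hk⟩ : ∃ k, p = k + 2 := ⟨p - 2, by omega⟩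
  have hcoeff : (p : ℚ_[p]) * PowerSeries.coeff p ℓ = ((PowerSeries.coeff (p - 1) E₀.formalInvDiff : ℤ) : ℚ_[p]) := by
    have hpk : PowerSeries.coeff p ℓ = PowerSeries.coeff (k + 2) ℓ :=
      congrArg (fun i ↦ PowerSeries.coeff i ℓ) hk
    have h1 : PowerSeries.coeff p ℓ = algebraMap ℚ ℚ_[p] (1 / (k + 2 : ℚ)) *
        PowerSeries.coeff (k + 1) (E₀.map (Int.castRingHom ℚ_[p])).formalOmega := by
      rw [hpk, hℓ, WeierstrassCurve.formalLog, PowerSeries.coeff_mk]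
    have h2 : (E₀.map (Int.castRingHom ℚ_[p])).formalOmega = E₀.formalInvDiff.map (Int.castRingHom ℚ_[p]) := by
      rw [← WeierstrassCurve.formalInvDiff_eq_formalOmega, WeierstrassCurve.map_formalInvDiff]
    have hk1 : k + 1 = p - 1 := by omega
    rw [h1, h2, PowerSeries.coeff_map, eq_intCast, hk1, ← mul_assoc]
    have hp0 : (p : ℚ_[p]) ≠ 0 := by exact_mod_cast hp.out.ne_zero
    have h3 : (p : ℚ_[p]) * algebraMap ℚ ℚ_[p] (1 / (k + 2 : ℚ)) = 1 := by
      rw [eq_ratCast, show ((k : ℚ) + 2) = (p : ℚ) by rw [hk]; push_cast; ring]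
      push_cast
      field_simp
    rw [h3, one_mul]
  have hdvd1 : (p : ℤ) ∣ PowerSeries.coeff (p - 1) E₀.formalInvDiff - a p :=
    dvd_sub_of_hondaShift hTℓ hℓ1 hcoeff
  have hdvd2 := dvd_coeff_formalInvDiff_sub_frobeniusTrace E₀ hp2 hpΔ
  have := dvd_sub hdvd2 hdvd1
  rwa [sub_sub_sub_cancel_left] at this

/-- **Equality from the congruence and Hasse's bounds**: if `p ∣ a − b`, `|a| ≤ 2√p`, `|b| ≤ 2√p`
and `p > 16`, then `a = b`. [folklore] -/
theorem eq_of_dvd_sub_of_abs_le {a b : ℤ} (h : (p : ℤ) ∣ a - b) (ha : |(a : ℝ)| ≤ 2 * Real.sqrt p)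
    (hb : |(b : ℝ)| ≤ 2 * Real.sqrt p) (hp16 : 16 < p) : a = b := by
  obtain ⟨c, hc⟩ := h
  have hsq : Real.sqrt (p : ℝ) * Real.sqrt p = p := Real.mul_self_sqrt (by positivity)
  have hsqrt4 : 4 < Real.sqrt (p : ℝ) := by
    rw [show (4 : ℝ) = Real.sqrt 16 by rw [show (16 : ℝ) = 4 ^ 2 by norm_num, Real.sqrt_sq (by norm_num)]]
    exact Real.sqrt_lt_sqrt (by norm_num) (by exact_mod_cast hp16)
  have habs : |((a - b : ℤ) : ℝ)| < p := by
    calc |((a - b : ℤ) : ℝ)| = |(a : ℝ) - b| := by push_cast; rfl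
      _ ≤ |(a : ℝ)| + |(b : ℝ)| := abs_sub _ _
      _ ≤ 4 * Real.sqrt p := by linarith
      _ < Real.sqrt p * Real.sqrt p := by nlinarith
      _ = p := hsq
  rw [hc] at habs
  push_cast at habs
  rw [abs_mul, Nat.abs_cast] at habs
  have hc0 : c = 0 := by
    by_contra hc0
    have h1 : (1 : ℝ) ≤ |(c : ℝ)| := by exact_mod_cast Int.one_le_abs hc0
    have hp0 : (0 : ℝ) < p := by exact_mod_cast hp.out.pos
    nlinarith
  rw [hc0, mul_zero, sub_eq_zero] at hc
  exact hc

end OnePrime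

/-! ### Assembly: the cofinite congruence relation for `ℂ/Λ_f`, and the named fact from Faltings -/

section Assembly

open Literature.NumberTheory.Automorphic (numPointsMod frobeniusTrace)

variable {N : ℕ} [NeZero N]

/-- `D q ∈ ℤ` as soon as `den q ∣ D`, and then `Dⁱ⁺¹ q ∈ ℤ`. [folklore] -/
theorem exists_int_pow_mul_rat (q : ℚ) {D : ℕ} (hq : q.den ∣ D) (i : ℕ) :
    ∃ z : ℤ, (D : ℚ) ^ (i + 1) * q = z := by
  obtain ⟨c, hc⟩ := hq
  refine ⟨(D : ℤ) ^ i * (c * q.num), ?_⟩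
  rw [pow_succ, mul_assoc, hc, Nat.cast_mul, mul_comm (q.den : ℚ), mul_assoc, Rat.den_mul_eq_num]
  push_cast; ring

/-- **The Eichler–Shimura congruence relation for `ℂ/Λ_f`, cofinitely, for the newform of an
elliptic curve `W/ℚ` — by Honda's formal-group method.** Let `f ∈ S₂(Γ₀(N))` be the newform of
`W` (`IsNewformOf W f`), `L_f` a period pair spanning `Λ_f` and `a₄, a₆ ∈ ℚ` with
`g₂(L_f) = −4a₄`, `g₃(L_f) = −4a₆`, so that `E : y² = x³ + a₄x + a₆` is the elliptic curve
`ℂ/Λ_f` over `ℚ` (Knapp 1993, Thm. 11.74 (d)). Then `a_p(f) = a_p(E)` for all but finitely many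
primes `p` (Shimura 1971, Thm. 7.15; Knapp, Thm. 11.74 (e)), proved here along Honda 1970, §6.2:
with an integral model `E₀ : y² = x³ + d⁴a₄x + d⁶a₆` (`a_p(E) = a_p(E₀)`, `LFunction_smul`) and
the homothetic lattice `d⁻¹Λ_f ⊇ Λ_f` one has `log_{E₀}(z(q)) = Σ aₙ(W)qⁿ/n` for the expansion
`z(q) ∈ ℚ⟦q⟧` of `−X/Y` along the modular parametrisation (`exists_formalLog_subst_eq`), with
bounded denominators (`exists_int_series_of_mul_yFn_eq`); for `p` off the finite set of primes
dividing `6·N·Δ(E₀)`, the leading coefficient of the denominator series, the Hasse modulus of `W`,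
or `p ≤ 16`, Honda's congruence (`dvd_sub_frobeniusTrace_of_formalLog_subst_eq`) and Hasse's
bounds give `a_p(W) = a_p(E₀)`. [cite: ShimuraIATAF1971, Thm. 7.15]
[cite: Honda1970, §6.2 (pp. 241–242)] [cite: Knapp1993, Thm. 11.74 (e)] -/
theorem IsNewformOf.finite_setOf_cuspCoeff_ne_lFunction_shortModel {W : WeierstrassCurve ℚ}
    [W.IsElliptic] {f : CuspForm (Gamma0 N) 2} (hf : IsNewformOf W f) (Lf : PeriodPair)
    (hLf : Lf.lattice.toAddSubgroup = periodLattice f) (a₄ a₆ : ℚ) (h₂ : Lf.g₂ = -4 * (a₄ : ℂ))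
    (h₃ : Lf.g₃ = -4 * (a₆ : ℂ)) :
    {p : ℕ | p.Prime ∧ (qExpansion 1 ⇑f).coeff p ≠
      (({ a₁ := 0, a₂ := 0, a₃ := 0, a₄ := a₄, a₆ := a₆ } : WeierstrassCurve ℚ).LFunction p : ℂ)}.Finite := by
  classical
  have hf0 : f ≠ 0 := hf.1.ne_zero
  -- Step 1: an integral model `E₀ : y² = x³ + Ax + B`, `A = d⁴a₄`, `B = d⁶a₆`
  set d : ℕ := a₄.den * a₆.den with hd
  have hdpos : 0 < d := Nat.mul_pos a₄.den_pos a₆.den_pos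
  have hdQ : (d : ℚ) ≠ 0 := by exact_mod_cast hdpos.ne'
  have hdC : (d : ℂ) ≠ 0 := by exact_mod_cast hdpos.ne'
  obtain ⟨A, hA⟩ := exists_int_pow_mul_rat a₄ (D := d) ⟨a₆.den, by rw [hd]⟩ 3
  obtain ⟨B, hB⟩ := exists_int_pow_mul_rat a₆ (D := d) ⟨a₄.den, by rw [hd, mul_comm]⟩ 5
  have hA' : ((A : ℤ) : ℚ) = (d : ℚ) ^ 4 * a₄ := by rw [← hA]
  have hB' : ((B : ℤ) : ℚ) = (d : ℚ) ^ 6 * a₆ := by rw [← hB]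
  set E₀ : WeierstrassCurve ℤ := { a₁ := 0, a₂ := 0, a₃ := 0, a₄ := A, a₆ := B } with hE₀
  set Cd : WeierstrassCurve.VariableChange ℚ := ⟨Units.mk0 (d : ℚ) hdQ, 0, 0, 0⟩ with hCd
  have hmodel : Cd • E₀.map (Int.castRingHom ℚ) =
      ({ a₁ := 0, a₂ := 0, a₃ := 0, a₄ := a₄, a₆ := a₆ } : WeierstrassCurve ℚ) := by
    ext
    · simp [WeierstrassCurve.variableChange_a₁, hE₀, hCd, WeierstrassCurve.map]
    · simp [WeierstrassCurve.variableChange_a₂, hE₀, hCd, WeierstrassCurve.map]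
    · simp [WeierstrassCurve.variableChange_a₃, hE₀, hCd, WeierstrassCurve.map]
    · rw [WeierstrassCurve.variableChange_a₄]
      simp only [hE₀, hCd, WeierstrassCurve.map, map_zero, eq_intCast, Units.val_inv_eq_inv_val, Units.val_mk0,
        mul_zero, sub_zero, add_zero, hA']
      field_simp
      ring
    · rw [WeierstrassCurve.variableChange_a₆]
      simp only [hE₀, hCd, WeierstrassCurve.map, map_zero, eq_intCast, Units.val_inv_eq_inv_val, Units.val_mk0,
        mul_zero, sub_zero, zero_mul, add_zero, zero_pow (by norm_num : (3 : ℕ) ≠ 0), hB']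
      field_simp
      ring
  haveI hEll : ({ a₁ := 0, a₂ := 0, a₃ := 0, a₄ := a₄, a₆ := a₆ } : WeierstrassCurve ℚ).IsElliptic :=
    isElliptic_shortModel h₂ h₃
  haveI hE₀ell : (E₀.map (Int.castRingHom ℚ)).IsElliptic := by
    have : Cd⁻¹ • (Cd • E₀.map (Int.castRingHom ℚ)) = E₀.map (Int.castRingHom ℚ) := inv_smul_smul _ _
    rw [← this, hmodel]
    infer_instance
  have hΔ0 : E₀.Δ ≠ 0 := by
    intro h0
    have : (E₀.map (Int.castRingHom ℚ)).Δ = 0 := by rw [WeierstrassCurve.map_Δ, h0, map_zero]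
    exact (E₀.map (Int.castRingHom ℚ)).Δ'.ne_zero (by rw [WeierstrassCurve.coe_Δ']; exact this)
  have hLfun : ∀ p : ℕ, ({ a₁ := 0, a₂ := 0, a₃ := 0, a₄ := a₄, a₆ := a₆ } : WeierstrassCurve ℚ).LFunction p =
      (E₀.map (Int.castRingHom ℚ)).LFunction p := fun p ↦ by
    rw [← hmodel, WeierstrassCurve.LFunction_smul]
  -- Step 2: the homothetic period pair `d⁻¹ Λ_f` and a presentation of `x`
  set L₀ : PeriodPair := Lf.mulLeft ((d : ℂ)⁻¹) (inv_ne_zero hdC) with hL₀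
  have hAC : ((A : ℤ) : ℂ) = (d : ℂ) ^ 4 * a₄ := by exact_mod_cast hA'
  have hBC : ((B : ℤ) : ℂ) = (d : ℂ) ^ 6 * a₆ := by exact_mod_cast hB'
  have h₂' : L₀.g₂ = -4 * ((A : ℤ) : ℂ) := by
    rw [hL₀, PeriodPair.g₂_mulLeft, h₂, hAC, inv_pow, inv_inv]; ring
  have h₃' : L₀.g₃ = -4 * ((B : ℤ) : ℂ) := by
    rw [hL₀, PeriodPair.g₃_mulLeft, h₃, hBC, inv_pow, inv_inv]; ring
  have hΛ : ∀ x ∈ periodLattice f, x ∈ L₀.lattice := by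
    intro x hx
    have hx' : x ∈ Lf.lattice := by
      have : x ∈ Lf.lattice.toAddSubgroup := by rw [hLf]; exact hx
      exact this
    rw [hL₀, PeriodPair.mem_mulLeft_lattice, inv_inv, ← nsmul_eq_mul]
    exact nsmul_mem hx' d
  obtain ⟨k, F, G, hk, hG0, hFG⟩ := exists_presentation_gamma0 f hf0 L₀ hΛ
  have hpres : IsXPresentation f L₀ F G := ⟨hG0, hFG⟩
  -- Step 3: `log_{E₀}(z(q)) = Σ aₙ qⁿ/n` and bounded denominators
  obtain ⟨z, hz0, hzy, hlog⟩ := hpres.exists_formalLog_subst_eq hf0 h₂' h₃'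
  have hint : ∀ n, ∃ m : ℤ, (m : ℂ) = cuspCoeff f n := fun n ↦ ⟨W.LFunction n, (hf.2 n).symm⟩
  obtain ⟨zq, P, Q, hzq, hQ0, hzQP⟩ := hpres.exists_int_series_of_mul_yFn_eq hf0 (by omega) hint
    ⟨-4 * (A : ℚ), by rw [h₂']; push_cast; ring⟩ ⟨-4 * (B : ℚ), by rw [h₃']; push_cast; ring⟩ hzy
  -- the identity over `ℚ`
  have hinj : Function.Injective (PowerSeries.map (algebraMap ℚ ℂ)) := by
    intro u v huv
    ext n
    have := congrArg (PowerSeries.coeff n) huv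
    rw [PowerSeries.coeff_map, PowerSeries.coeff_map] at this
    exact (algebraMap ℚ ℂ).injective this
  have hzq0 : PowerSeries.constantCoeff zq = 0 := by
    have h := congrArg (PowerSeries.coeff 0) hzq
    rw [PowerSeries.coeff_map] at h
    simp only [PowerSeries.coeff_zero_eq_constantCoeff_apply] at h
    rw [hz0] at h
    exact (map_eq_zero_iff (algebraMap ℚ ℂ) (algebraMap ℚ ℂ).injective).mp h
  have hE₀C : (E₀.map (Int.castRingHom ℚ)).map (algebraMap ℚ ℂ) =
      ({ a₁ := 0, a₂ := 0, a₃ := 0, a₄ := ((A : ℤ) : ℂ), a₆ := ((B : ℤ) : ℂ) } : WeierstrassCurve ℂ) := by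
    rw [WeierstrassCurve.map_map, RingHom.ext_int ((algebraMap ℚ ℂ).comp (Int.castRingHom ℚ)) (Int.castRingHom ℂ)]
    simp [hE₀, WeierstrassCurve.map]
  have hlogQ : (E₀.map (Int.castRingHom ℚ)).formalLog.subst zq =
      PowerSeries.mk fun n ↦ ((W.LFunction n : ℤ) : ℚ) / n := by
    apply hinj
    rw [map_subst_apply (PowerSeries.HasSubst.of_constantCoeff_zero' hzq0), WeierstrassCurve.map_formalLog,
      hE₀C, hzq, hlog]
    ext n
    rw [PowerSeries.coeff_mk, PowerSeries.coeff_map, PowerSeries.coeff_mk, hf.2, map_div₀, map_natCast,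
      eq_ratCast, Rat.cast_intCast]
  -- Step 4: the finite exceptional set
  obtain ⟨MW, hMW0, hMW⟩ := exists_abs_lFunction_le W
  set q₀ : ℤ := PowerSeries.coeff Q.order.toNat Q with hq₀
  have hq₀0 : q₀ ≠ 0 := PowerSeries.coeff_order hQ0
  set M : ℕ := MW * N * E₀.Δ.natAbs * q₀.natAbs with hM
  have hM0 : M ≠ 0 := mul_ne_zero (mul_ne_zero (mul_ne_zero hMW0 (NeZero.ne N))
    (Int.natAbs_ne_zero.mpr hΔ0)) (Int.natAbs_ne_zero.mpr hq₀0)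
  refine Set.Finite.subset ((Nat.divisors M).finite_toSet.union (Finset.range 17).finite_toSet) ?_
  rintro p ⟨hp, hne⟩
  by_contra hpS
  have hpM : ¬ p ∣ M := fun h ↦ hpS (Or.inl (Finset.mem_coe.mpr (Nat.mem_divisors.mpr ⟨h, hM0⟩)))
  have hp16 : 16 < p := by
    by_contra h16
    exact hpS (Or.inr (Finset.mem_coe.mpr (Finset.mem_range.mpr (by omega))))
  apply hne
  haveI := Fact.mk hp
  -- `p` avoids every factor of `M`
  have hpMW : ¬ p ∣ MW := fun h ↦ hpM (h.trans ⟨N * E₀.Δ.natAbs * q₀.natAbs, by rw [hM]; ring⟩)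
  have hpN : ¬ p ∣ N := fun h ↦ hpM (h.trans ⟨MW * E₀.Δ.natAbs * q₀.natAbs, by rw [hM]; ring⟩)
  have hpΔ : ¬ (p : ℤ) ∣ E₀.Δ := fun h ↦ hpM
    ((Int.natCast_dvd.mp h).trans ⟨MW * N * q₀.natAbs, by rw [hM]; ring⟩)
  have hlead : ¬ (p : ℤ) ∣ q₀ := fun h ↦ hpM
    ((Int.natCast_dvd.mp h).trans ⟨MW * N * E₀.Δ.natAbs, by rw [hM]; ring⟩)
  have hp2 : p ≠ 2 := by omega
  have hp3 : p ≠ 3 := by omega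
  -- Step 5: Honda's congruence and Hasse's bounds
  have hdvd : (p : ℤ) ∣ W.LFunction p - frobeniusTrace E₀ p :=
    dvd_sub_frobeniusTrace_of_formalLog_subst_eq E₀ hp2 hpΔ (fun n ↦ W.LFunction n)
      ArithmeticFunction.map_zero W.LFunction_apply_one
      (fun n hn ↦ hf.lFunction_prime_mul hp hpN n) hzq0 hlogQ hlead hzQP
  have heq : (W.LFunction p : ℤ) = frobeniusTrace E₀ p :=
    eq_of_dvd_sub_of_abs_le hdvd (hMW p hp hpMW) (abs_frobeniusTrace_le E₀ hp2 hp3 hpΔ) hp16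
  change cuspCoeff f p = _
  rw [hf.2, hLfun, Literature.NumberTheory.Automorphic.lFunction_map_apply_prime_of_not_dvd E₀ hp hpΔ, heq]

/-- **`IsNewformOf.exists_maninConstant_ne_zero` from Faltings' isogeny theorem alone.** For an
elliptic curve `W/ℚ`, its newform `f ∈ S₂(Γ₀(N))` and any Néron-type period pair `L` of `W`,
some non-zero integer `c` has `c·Λ_f ⊆ Λ_L` — granted only Faltings' theorem
`WeierstrassCurve.isIsogenous_iff_frobeniusTrace_eq` (Faltings 1983, §5 Kor. 2): the other input of
the tree's reduction `IsNewformOf.exists_int_mul_mem_of_congruenceRelation_cofinite`, the cofinite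
Eichler–Shimura congruence relation for `ℂ/Λ_f` (Shimura 1971, Thm. 7.15), is now the theorem
`IsNewformOf.finite_setOf_cuspCoeff_ne_lFunction_shortModel` (Honda's formal-group method). This is
BCDT's "(2) ⇒ (6) follows from a construction of Shimura and a theorem of Faltings" with Shimura's
construction carried out in the tree. [cite: BCDTJAMS2001, p. 845, "(2) ⇒ (6)"]
[cite: Faltings1983Endlichkeit, §5 Korollar 2 (i) ⟺ (iii)] [cite: ShimuraIATAF1971, Thm. 7.14 and Thm. 7.15] -/
theorem IsNewformOf.exists_maninConstant_ne_zero_of_faltings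
    (hF : WeierstrassCurve.isIsogenous_iff_frobeniusTrace_eq) :
    IsNewformOf.exists_maninConstant_ne_zero := by
  intro W _ N _ f hf L hL
  exact hf.exists_int_mul_mem_of_congruenceRelation_cofinite hF
    (fun Lf hLf a₄ a₆ h₂ h₃ ↦ hf.finite_setOf_cuspCoeff_ne_lFunction_shortModel Lf hLf a₄ a₆ h₂ h₃) hL

end Assembly



end Literature.NumberTheory.EllipticCurves.ModularForms
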